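import Summits.KontsevichZagierPeriods.Zeta5Search.WellPoisedFaceWindows
import Summits.KontsevichZagierPeriods.Zeta5Search.LaiSaving
import HarnessLib

/-!
# Well-poised face forms — Lemma 19 COMPLETE on the face: `Λ_n = D_{M₁}³D_{M₂}D_{M₃}D_{M₄}·Φ⁻¹·F(h_n) ∈ ℤζ(5)+ℤ`

pub-zeta5 · fam-vwp generation 7, file 8.  HONEST FRAMING: systematic search; no irrationality claim unless
certified.  Nothing here is evidence about `ζ(5)`: the forms `Λ_n` tend to `+∞`
(`WellPoisedFaceGrowth.faceLambda_tendsto_atTop`), so their integrality proves nothing.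

`WellPoisedFaceWindows` proved `Π·F(h_n) ∈ ℤζ(5) + ℤ`, `Π = D_{M₁}³D_{M₂}D_{M₃}D_{M₄}`.  This file removes
Zudilin's arithmetic factor `Φ(h_n) = ∏_{√h₀ < p ≤ M₄} p^{ν_p}` [Zudilin2004, (8.9)] (`WellPoisedFaceGrowth.facePhi`,
gen 6's verbatim typing of (8.9) with `r = 3`, `q = 7`, `h₁ = h₂ = h₃ = 1`):

* `faceLambda_mem` — for every SORTED integral face direction and every `n` with `η₀ n ≥ 7`:
  `Λ_n ∈ ℤ·ζ(5) + ℤ` ([Zudilin2004, Lemma 19] on the face, kernel-checked).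

The restriction `η₀ n ≥ 7` (i.e. `h₀ ≥ 9`, so that every prime `p > √h₀` of `Φ` is `≥ 5 > J = 4`) comes from
fam-indep's port of [Zudilin2004, Lemmas 17–18] (`lai_pf_padicOrdGe`, stated for primes `p ≥ J`); it
excludes finitely many `n` per direction and is irrelevant for `Λ_n → ∞`.

## Method (prime by prime, [Zudilin2004, (8.11)])
For a prime `p` of `Φ` (`√h₀ < p ≤ M₄`, hence `η₀ n < p²`, `p ≥ 5`): `ord_p Π = 6` (each `D_{M_i}` once);
`ord_p ĉ_{o,k} ≥ φ(k) − (3−o)` with `φ(k) =` Lai's `laiPhiDiv 4 0 η₀ n η k p` (`lai_pf_padicOrdGe`), and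
`ν_p = min_k ν_{k,p} ≤ ν_{k+1,p} = φ(k)` (`nuKP_face_eq_laiPhiDiv`: on the face the three pair summands of (8.9)
vanish and the four brick summands are Lai's); `ord_p H_k^{(o+3)} ≥ −(o+3)` (`k < p²`).  Hence
`ord_p(Π·A) ≥ ν_p + 5` and `ord_p(Π·B) ≥ ν_p`; with `Π·A, Π·B ∈ ℤ` (`WellPoisedFaceWindows`) this gives
`Π·A/Φ, Π·B/Φ ∈ ℤ` (`Rat.exists_int_of_padicOrdGe`).
-/

noncomputable section

open Finset Filter Polynomial

namespace Summit.KontsevichZagierPeriods.Zeta5Search.WellPoisedFaceRate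

open Literature.NumberTheory.Transcendental
open Literature.NumberTheory.Transcendental.BallRivoal (pfEval IsInt poch harm)
open Summit.KontsevichZagierPeriods.Zeta5Search.WellPoisedFace (Phi mLast nuP nuKP brickTerm pairTerm
  pairTerm_one nuKP_nonneg)

variable (η₀ : ℕ) (η : Fin 4 → ℕ) (n : ℕ)

/-! ## 1. `Φ(h_n)` as a product of prime powers -/

/-- Zudilin's exponent `ν_p` [(8.9)] at the face parameters. -/
def faceNu (p : ℕ) : ℤ := nuP (h0Z η₀ n) 1 1 1 (hZ η n 0) (hZ η n 1) (hZ η n 2) (hZ η n 3) p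

/-- The primes of `Φ(h_n)`: `√h₀ < p ≤ M₄`. -/
def facePhiSet : Finset ℕ :=
  (Ioc (Nat.sqrt (h0Z η₀ n).toNat) (faceMZ η₀ η n 3).toNat).filter Nat.Prime

/-- `Φ(h_n) = ∏_{p ∈ facePhiSet} p^{ν_p}` (definitional). -/
theorem facePhi_eq_prod : facePhi η₀ η n = ∏ p ∈ facePhiSet η₀ η n, p ^ (faceNu η₀ η n p).toNat := rfl

/-- `ord_p Φ(h_n) = ν_p` for the primes of `Φ`, `= 0` otherwise. -/
theorem padicValNat_facePhi (p : ℕ) [hp : Fact p.Prime] :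
    padicValNat p (facePhi η₀ η n) = if p ∈ facePhiSet η₀ η n then (faceNu η₀ η n p).toNat else 0 := by
  rw [facePhi_eq_prod]
  exact Zudilin2004.padicValNat_prod_prime_pow _ (fun q hq => (mem_filter.1 hq).2) _

/-- `ν_p ≥ 0`. -/
theorem faceNu_nonneg (p : ℕ) (hp : 0 < p) : 0 ≤ faceNu η₀ η n p := by
  unfold faceNu nuP
  split_ifs with h
  · exact Finset.le_inf' _ _ fun k _ => nuKP_nonneg _ _ _ _ _ _ _ _ k (by exact_mod_cast hp)
  · exact le_rfl

/-- A prime of `Φ(h_n)`: `p` prime, `h₀ = η₀ n + 2 < p²`, `p ≤ M₄ = n · m₄`. -/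
theorem mem_facePhiSet (hη : ∀ j, 2 * η j < η₀) {p : ℕ} (hp : p ∈ facePhiSet η₀ η n) :
    p.Prime ∧ η₀ * n + 2 < p ^ 2 ∧ p ≤ n * faceM η₀ η 3 := by
  simp only [facePhiSet, mem_filter, mem_Ioc, faceMZ_toNat η₀ η hη n 3, h0Z, Int.toNat_natCast] at hp
  exact ⟨hp.2, Nat.sqrt_lt'.1 hp.1.1, hp.1.2⟩

/-! ## 2. `ν_{k+1,p}` on the face is Lai's `φ(k)` -/

/-- Index shift in one brick summand of (8.9): `h₀ = a + 2`, `h_j = d + 1`, `k ↦ k + 1`. -/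
theorem brickTerm_shift (H0 Hj K P a d : ℤ) (h0 : H0 = a + 2) (hj : Hj = d + 1) :
    brickTerm H0 Hj (K + 1) P = (a - 2 * d) / P - (K - d) / P - (a - d - K) / P := by
  subst h0 hj
  have n1 : a + 2 - 2 * (d + 1) = a - 2 * d := by ring
  have n2 : K + 1 - (d + 1) = K - d := by ring
  have n3 : a + 2 - (d + 1) - (K + 1) = a - d - K := by ring
  unfold brickTerm
  rw [n1, n2, n3]

/-- **`ν_{k+1,p}(h_n) = φ̃(k)`**: Zudilin's exponent (8.9) at the face parameters (`r = 3` with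
`h₁ = h₂ = h₃ = 1`: the pair summands vanish, `pairTerm_one`) is Lai's `laiPhiDiv 4 0 η₀ n η k p`
(pole index `k` of the frame `(t+1)_{η₀n+1}` ↔ Zudilin's pole `t = −(k+1)`). -/
theorem nuKP_face_eq_laiPhiDiv (hη : ∀ j, 2 * η j < η₀) (k p : ℕ) :
    nuKP (h0Z η₀ n) 1 1 1 (hZ η n 0) (hZ η n 1) (hZ η n 2) (hZ η n 3) ((k : ℤ) + 1) p
      = laiPhiDiv 4 0 η₀ n η k p := by
  have hb : ∀ j : Fin 4, brickTerm (h0Z η₀ n) (hZ η n j) ((k : ℤ) + 1) p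
      = ((((η₀ - 2 * η j) * n : ℕ) : ℤ)) / p - ((k : ℤ) - ((η j * n : ℕ) : ℤ)) / p
        - (((((η₀ - η j) * n : ℕ) : ℤ)) - k) / p := by
    intro j
    have hj := (hη j).le
    have e1 : (((η₀ - 2 * η j) * n : ℕ) : ℤ) = (η₀ : ℤ) * n - 2 * ((η j : ℤ) * n) := by
      rw [Nat.cast_mul, Nat.cast_sub hj]; push_cast; ring
    have e2 : (((η₀ - η j) * n : ℕ) : ℤ) = (η₀ : ℤ) * n - (η j : ℤ) * n := by
      rw [Nat.cast_mul, Nat.cast_sub (by omega)]; ring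
    rw [brickTerm_shift (h0Z η₀ n) (hZ η n j) k p ((η₀ : ℤ) * n) ((η j : ℤ) * n)
      (by unfold h0Z; push_cast; ring) (by unfold hZ; push_cast; ring), e1, e2, Nat.cast_mul]
  simp only [nuKP, pairTerm_one, zero_add, hb, laiPhiDiv, Fin.sum_univ_four, Nat.cast_zero,
    zero_mul, mul_zero, add_zero, sub_zero]
  ring

/-- **`ν_p ≤ φ̃(k)`** for every pole index `k` of the big window `[η_(1) n, (η₀ − η_(1)) n]`. -/
theorem faceNu_le_laiPhiDiv (hη : ∀ j, 2 * η j < η₀) (p : ℕ) {k : ℕ} (hk₁ : η 0 * n ≤ k)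
    (hk₂ : k ≤ (η₀ - η 0) * n) : faceNu η₀ η n p ≤ laiPhiDiv 4 0 η₀ n η k p := by
  have hsub : (((η₀ - η 0) * n : ℕ) : ℤ) = (η₀ : ℤ) * n - (η 0 : ℤ) * n := by
    rw [Nat.cast_mul, Nat.cast_sub (by have := hη 0; omega)]; ring
  have hk₂' : (k : ℤ) ≤ (η₀ : ℤ) * n - (η 0 : ℤ) * n := by rw [← hsub]; exact_mod_cast hk₂
  have hk₁' : (η 0 : ℤ) * n ≤ k := by exact_mod_cast hk₁
  have hmem : ((k : ℤ) + 1) ∈ Icc (hZ η n 0) (h0Z η₀ n - hZ η n 0) := by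
    simp only [mem_Icc, hZ, h0Z]; push_cast; constructor <;> linarith
  have h4 : hZ η n 0 ≤ h0Z η₀ n - hZ η n 0 := (mem_Icc.1 hmem).1.trans (mem_Icc.1 hmem).2
  unfold faceNu nuP
  rw [dif_pos h4]
  exact (Finset.inf'_le _ hmem).trans (nuKP_face_eq_laiPhiDiv η₀ η n hη k p).le

/-! ## 3. `p`-adic orders at the primes of `Φ` -/

/-- `ord_p Π ≥ 6` for `p ≤ M₄ ≤ M_i ≤ η₀ n < p²` (each `ord_p D_{M_i} = 1`). -/
theorem padicOrdGe_facePi (h01 : η 0 ≤ η 1) (h12 : η 1 ≤ η 2) (h23 : η 2 ≤ η 3) {p : ℕ} [hp : Fact p.Prime]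
    (hp1 : p ≤ n * faceM η₀ η 3) (hp2 : η₀ * n < p ^ 2) :
    PadicOrdGe p 6 ((facePi η₀ η n : ℕ) : ℚ) := by
  have e0 : etaN η 0 = η 0 := by simpa using etaN_fin η 0
  have e3 : etaN η 3 = η 3 := by simpa using etaN_fin η 3
  have hj : ∀ i ∈ range 6, PadicOrdGe p 1 ((dFac η₀ η n i : ℕ) : ℚ) := fun i hi => by
    refine Or.inr (le_of_eq ?_)
    rw [padicValRat.of_nat]
    have hle : etaN η (i - 2) ≤ etaN η 3 :=
      etaN_mono η h01 h12 h23 (by have := mem_range.1 hi; omega) (by norm_num)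
    have h1 : p ≤ n * max (η₀ - 2 * etaN η 0) (η₀ - etaN η (i - 2)) := hp1.trans (by
      unfold faceM
      rw [e0, ← e3]
      exact Nat.mul_le_mul_left n (max_le_max le_rfl (Nat.sub_le_sub_left hle η₀)))
    have h2 : n * max (η₀ - 2 * etaN η 0) (η₀ - etaN η (i - 2)) < p ^ 2 :=
      lt_of_le_of_lt (by rw [mul_comm]; exact Nat.mul_le_mul_right n (max_le (Nat.sub_le _ _) (Nat.sub_le _ _)))
        hp2
    unfold dFac
    rw [Zudilin2004.padicValNat_lcmUpto_eq_one h1 h2]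
    simp
  have h := PadicOrdGe.prod hj
  rw [facePi, Nat.cast_prod]
  simpa using h

/-- Common hypotheses of the Lai lemmas on a sorted face. -/
theorem face_hyps (h01 : η 0 ≤ η 1) (h12 : η 1 ≤ η 2) (h23 : η 2 ≤ η 3) (h3 : 2 * η 3 < η₀) :
    (∀ j, 2 * η j ≤ η₀) ∧ 0 < η₀ ∧ (∀ j, etaN η 0 ≤ η j) ∧ 2 * etaN η 0 < η₀ ∧ etaN η 0 = η 0 := by
  have hη := two_mul_lt_of_sorted η₀ η h01 h12 h23 h3
  have e0 : etaN η 0 = η 0 := by simpa using etaN_fin η 0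
  refine ⟨fun j => (hη j).le, by have := hη 0; omega, fun j => ?_, by rw [e0]; exact hη 0, e0⟩
  rw [e0]; exact eta_mono η h01 h12 h23 (Fin.zero_le j)

/-- `ĉ_{o,k} = 0` beyond the frame. -/
theorem faceDataOf_eq_zero_of_lt (c : ℕ → ℕ → ℚ) {o k : ℕ} (h : η₀ * n < k) :
    faceDataOf η₀ η n c o k = 0 := by
  simp [faceDataOf, not_le.2 h]

/-- **(8.11) on the face: `ord_p ĉ_{o,k} ≥ ν_p − (3 − o)`** for a prime `p ≥ 4` with `η₀ n < p²`
(`lai_pf_padicOrdGe`: `ord_p ĉ_{o,k} ≥ φ̃(k) − (3−o)` on the window, and `ν_p ≤ φ̃(k)`). -/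
theorem padicOrdGe_faceData (h01 : η 0 ≤ η 1) (h12 : η 1 ≤ η 2) (h23 : η 2 ≤ η 3) (h3 : 2 * η 3 < η₀)
    {c : ℕ → ℕ → ℚ} (hc : c ∈ laiFaceData η₀ η n) {p : ℕ} [hp : Fact p.Prime] (hJp : 4 ≤ p)
    (hp2 : η₀ * n < p ^ 2) {o : ℕ} (ho : o < 4) (k : ℕ) :
    PadicOrdGe p (faceNu η₀ η n p - ((3 - o : ℕ) : ℤ)) (faceDataOf η₀ η n c o k) := by
  have hη := two_mul_lt_of_sorted η₀ η h01 h12 h23 h3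
  obtain ⟨hδ, hM, hmin, h2, e0⟩ := face_hyps η₀ η h01 h12 h23 h3
  by_cases hz : faceDataOf η₀ η n c o k = 0
  · rw [hz]; exact PadicOrdGe.zero _
  obtain ⟨hlo, hhi⟩ := faceData_window η₀ η n h01 h12 h23 h3 hc ho hz
  have hmono := etaN_mono η h01 h12 h23 (Nat.zero_le o) ho
  have hk₁ : etaN η 0 * n ≤ k := (Nat.mul_le_mul_right n hmono).trans hlo
  have hk₂ : k ≤ (η₀ - etaN η 0) * n := hhi.trans (Nat.mul_le_mul_right n (Nat.sub_le_sub_left hmono η₀))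
  have hkM : k ≤ η₀ * n := hk₂.trans (Nat.mul_le_mul_right n (Nat.sub_le _ _))
  have hval : faceDataOf η₀ η n c o k = laiC 4 0 η₀ n η * c o k := by
    simp only [faceDataOf, if_pos (And.intro ho hkM)]
  have h1 := lai_pf_padicOrdGe 4 0 η₀ n η hδ hM hc (etaN η 0) hmin h2 hJp hp2 hk₁ hk₂ (s := o + 1)
    (by omega) (by omega)
  rw [Nat.add_sub_cancel] at h1
  rw [e0] at hk₁ hk₂
  have hν := faceNu_le_laiPhiDiv η₀ η n hη p hk₁ hk₂
  rw [hval]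
  exact h1.mono (by omega)

/-- **One term of `B`**: `ord_p (ĉ_{o,k} · H_k^{(o+3)}) ≥ ν_p − 6` (`ord_p H_k^{(o+3)} ≥ −(o+3)` as `k ≤ η₀ n < p²`). -/
theorem padicOrdGe_term (h01 : η 0 ≤ η 1) (h12 : η 1 ≤ η 2) (h23 : η 2 ≤ η 3) (h3 : 2 * η 3 < η₀)
    {c : ℕ → ℕ → ℚ} (hc : c ∈ laiFaceData η₀ η n) {p : ℕ} [hp : Fact p.Prime] (hJp : 4 ≤ p)
    (hp2 : η₀ * n < p ^ 2) {o : ℕ} (ho : o < 4) (k : ℕ) :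
    PadicOrdGe p (faceNu η₀ η n p - 6) (faceDataOf η₀ η n c o k * harm (o + 3) k) := by
  by_cases hkM : η₀ * n < k
  · rw [faceDataOf_eq_zero_of_lt η₀ η n c hkM, zero_mul]; exact PadicOrdGe.zero _
  have h1 := padicOrdGe_faceData η₀ η n h01 h12 h23 h3 hc hJp hp2 ho k
  have h3' := padicOrdGe_harm (p := p) (o + 3) k
  have hlog : padicValNat p (Nat.lcmUpto k) ≤ 1 :=
    Zudilin2004.padicValNat_lcmUpto_le_one (lt_of_le_of_lt (not_lt.1 hkM) hp2)
  have hcast : (((o + 3) * padicValNat p (Nat.lcmUpto k) : ℕ) : ℤ) ≤ ((o + 3 : ℕ) : ℤ) := by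
    exact_mod_cast (Nat.mul_le_mul_left (o + 3) hlog).trans (by simp)
  exact (h1.mul h3').mono (by push_cast at hcast ⊢; omega)

/-- For a prime of `Φ(h_n)` with `η₀ n ≥ 7`: `p ≥ 4`, `η₀ n < p²`, `p ≤ M₄`. -/
theorem facePhiSet_bounds (hη : ∀ j, 2 * η j < η₀) (hn : 7 ≤ η₀ * n) {p : ℕ}
    (hp : p ∈ facePhiSet η₀ η n) : 4 ≤ p ∧ η₀ * n < p ^ 2 ∧ p ≤ n * faceM η₀ η 3 := by
  obtain ⟨-, h2, h3⟩ := mem_facePhiSet η₀ η n hη hp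
  refine ⟨?_, by omega, h3⟩
  by_contra h
  have : p ^ 2 ≤ 3 ^ 2 := Nat.pow_le_pow_left (by omega) 2
  omega

/-- **`ord_p (Π·A) ≥ ν_p`** at every prime of `Φ(h_n)` (`A = 6Σ_k ĉ_{2,k}`; in fact `≥ ν_p + 5`). -/
theorem padicOrdGe_facePi_coefA (h01 : η 0 ≤ η 1) (h12 : η 1 ≤ η 2) (h23 : η 2 ≤ η 3)
    (h3 : 2 * η 3 < η₀) (hn : 7 ≤ η₀ * n) {c : ℕ → ℕ → ℚ} (hc : c ∈ laiFaceData η₀ η n) {p : ℕ}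
    (hpS : p ∈ facePhiSet η₀ η n) :
    PadicOrdGe p (faceNu η₀ η n p) (((facePi η₀ η n : ℕ) : ℚ) * coefA (η₀ * n) (faceDataOf η₀ η n c)) := by
  have hη := two_mul_lt_of_sorted η₀ η h01 h12 h23 h3
  obtain ⟨hJp, hp2, hp1⟩ := facePhiSet_bounds η₀ η n hη hn hpS
  haveI := Fact.mk (mem_facePhiSet η₀ η n hη hpS).1
  have hPi := padicOrdGe_facePi η₀ η n h01 h12 h23 hp1 hp2
  have hS : PadicOrdGe p (faceNu η₀ η n p - 1) (∑ k ∈ range (η₀ * n + 1), faceDataOf η₀ η n c 2 k) :=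
    PadicOrdGe.sum fun k _ => by
      simpa using padicOrdGe_faceData η₀ η n h01 h12 h23 h3 hc hJp hp2 (o := 2) (by norm_num) k
  have h6 : PadicOrdGe p 0 (6 : ℚ) := by simpa using PadicOrdGe.of_nat (p := p) 6
  rw [coefA]
  exact (hPi.mul (h6.mul hS)).mono (by omega)

/-- **`ord_p (Π·B) ≥ ν_p`** at every prime of `Φ(h_n)`. -/
theorem padicOrdGe_facePi_coefB (h01 : η 0 ≤ η 1) (h12 : η 1 ≤ η 2) (h23 : η 2 ≤ η 3)
    (h3 : 2 * η 3 < η₀) (hn : 7 ≤ η₀ * n) {c : ℕ → ℕ → ℚ} (hc : c ∈ laiFaceData η₀ η n) {p : ℕ}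
    (hpS : p ∈ facePhiSet η₀ η n) :
    PadicOrdGe p (faceNu η₀ η n p) (((facePi η₀ η n : ℕ) : ℚ) * coefB (η₀ * n) (faceDataOf η₀ η n c)) := by
  have hη := two_mul_lt_of_sorted η₀ η h01 h12 h23 h3
  obtain ⟨hJp, hp2, hp1⟩ := facePhiSet_bounds η₀ η n hη hn hpS
  haveI := Fact.mk (mem_facePhiSet η₀ η n hη hpS).1
  have hPi := padicOrdGe_facePi η₀ η n h01 h12 h23 hp1 hp2
  have c3 : PadicOrdGe p 0 (3 : ℚ) := by simpa using PadicOrdGe.of_nat (p := p) 3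
  have c6 : PadicOrdGe p 0 (6 : ℚ) := by simpa using PadicOrdGe.of_nat (p := p) 6
  have c10 : PadicOrdGe p 0 (10 : ℚ) := by simpa using PadicOrdGe.of_nat (p := p) 10
  have hS : PadicOrdGe p (faceNu η₀ η n p - 6) (coefB (η₀ * n) (faceDataOf η₀ η n c)) := by
    rw [coefB]
    refine PadicOrdGe.sum fun k _ => ?_
    have t0 := padicOrdGe_term η₀ η n h01 h12 h23 h3 hc hJp hp2 (o := 0) (by norm_num) k
    have t1 := padicOrdGe_term η₀ η n h01 h12 h23 h3 hc hJp hp2 (o := 1) (by norm_num) k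
    have t2 := padicOrdGe_term η₀ η n h01 h12 h23 h3 hc hJp hp2 (o := 2) (by norm_num) k
    have t3 := padicOrdGe_term η₀ η n h01 h12 h23 h3 hc hJp hp2 (o := 3) (by norm_num) k
    norm_num only [Nat.reduceAdd] at t0 t1 t2 t3
    exact ((t0.add ((c3.mul t1).mono (by omega))).add ((c6.mul t2).mono (by omega))).add
      ((c10.mul t3).mono (by omega))
  exact (hPi.mul hS).mono (by omega)

/-! ## 4. Division by `Φ(h_n)` and the theorem -/

/-- An integer `x` with `ord_p x ≥ ν_p` at every prime of `Φ(h_n)` is divisible by `Φ(h_n)`. -/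
theorem exists_int_div_facePhi {x : ℚ} (hx : ∃ z : ℤ, x = (z : ℚ))
    (hord : ∀ p ∈ facePhiSet η₀ η n, PadicOrdGe p (faceNu η₀ η n p) x) :
    ∃ z : ℤ, x / (facePhi η₀ η n : ℚ) = (z : ℚ) := by
  obtain ⟨z, rfl⟩ := hx
  refine Rat.exists_int_of_padicOrdGe fun p hp => ?_
  haveI := Fact.mk hp
  rw [div_eq_mul_inv]
  have hv := padicValNat_facePhi η₀ η n p
  have hinv := Zudilin2004.padicOrdGe_inv_natCast (p := p) (facePhi η₀ η n)
  by_cases hP : p ∈ facePhiSet η₀ η n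
  · rw [if_pos hP] at hv
    rw [hv, Int.toNat_of_nonneg (faceNu_nonneg η₀ η n p hp.pos)] at hinv
    simpa using ((hord p hP).mul hinv)
  · rw [if_neg hP] at hv
    rw [hv] at hinv
    simpa using (PadicOrdGe.of_int z).mul hinv

/-- **THEOREM ([Zudilin2004, Lemma 19] on the face, kernel).**  For every SORTED integral face direction
`(η₀; 0³, η_0 ≤ η_1 ≤ η_2 ≤ η_3)`, `2η_3 < η₀`, and every `n` with `η₀ n ≥ 7`, the normalised face form
`Λ_n = D_{M₁}³ D_{M₂} D_{M₃} D_{M₄} · Φ(h_n)⁻¹ · F(h_n)` (`WellPoisedFaceGrowth.faceLambda`) lies in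
`ℤ·ζ(5) + ℤ`.  (The forms tend to `+∞`; this is NOT evidence about `ζ(5)`.) -/
theorem faceLambda_mem (h01 : η 0 ≤ η 1) (h12 : η 1 ≤ η 2) (h23 : η 2 ≤ η 3) (h3 : 2 * η 3 < η₀)
    (hn : 7 ≤ η₀ * n) : ∃ a b : ℤ, faceLambda η₀ η n = (a : ℝ) * zetaValue 5 - (b : ℝ) := by
  have hη := two_mul_lt_of_sorted η₀ η h01 h12 h23 h3
  obtain ⟨c, hc⟩ := exists_laiFaceData η₀ η n hη
  have hF := faceF_eq_coef hη (faceRQ_eq_pfEval η₀ η n hη hc)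
  obtain ⟨a, ha⟩ := exists_int_div_facePhi η₀ η n (facePi_mul_coefA η₀ η n h01 h12 h23 h3 hc)
    fun p hp => padicOrdGe_facePi_coefA η₀ η n h01 h12 h23 h3 hn hc hp
  obtain ⟨b, hb⟩ := exists_int_div_facePhi η₀ η n (facePi_mul_coefB η₀ η n h01 h12 h23 h3 hc)
    fun p hp => padicOrdGe_facePi_coefB η₀ η n h01 h12 h23 h3 hn hc hp
  refine ⟨a, b, ?_⟩
  have ea : ((facePi η₀ η n : ℕ) : ℝ) / (facePhi η₀ η n : ℝ) * (coefA (η₀ * n) (faceDataOf η₀ η n c) : ℝ)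
      = (a : ℝ) := by
    have := congrArg (fun q : ℚ => (q : ℝ)) ha
    push_cast at this
    rw [← this]; ring
  have eb : ((facePi η₀ η n : ℕ) : ℝ) / (facePhi η₀ η n : ℝ) * (coefB (η₀ * n) (faceDataOf η₀ η n c) : ℝ)
      = (b : ℝ) := by
    have := congrArg (fun q : ℚ => (q : ℝ)) hb
    push_cast at this
    rw [← this]; ring
  rw [faceLambda_eq η₀ η n hη, hF, mul_sub, ← mul_assoc, ea, eb]

/-- Kernel instance: the MODEL face maximiser shape `(14; 0³, 4,4,5,5)` of FAMILY.md §13, every `n ≥ 1`. -/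
example (n : ℕ) (hn : 1 ≤ n) : ∃ a b : ℤ, faceLambda 14 ![4, 4, 5, 5] n = (a : ℝ) * zetaValue 5 - (b : ℝ) :=
  faceLambda_mem 14 ![4, 4, 5, 5] n (by decide) (by decide) (by decide) (by decide) (by omega)

/-- Kernel instance: the classical symmetric direction `(3; 0³, 1⁴)`, every `n ≥ 3`. -/
example (n : ℕ) (hn : 3 ≤ n) : ∃ a b : ℤ, faceLambda 3 ![1, 1, 1, 1] n = (a : ℝ) * zetaValue 5 - (b : ℝ) :=
  faceLambda_mem 3 ![1, 1, 1, 1] n (by decide) (by decide) (by decide) (by decide) (by omega)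

end Summit.KontsevichZagierPeriods.Zeta5Search.WellPoisedFaceRate
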